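import Summits.QuantumAdvantage.QuantumAdvantage.Theorems.CubicForrelationNearExactIsExactCubicFormRadical

/-!
# Crux `CubicForrelation.NearExactIsExact` (stmt-QuantumAdvantage-14043) — WHEN IS A QUADRATIC BALANCED: iff it is non-constant on the
  radical of its symplectic form

Certificate seat `b2b-cforr-cert` (gen 41).  HONEST FRAMING: kernel-checked folklore (standard axioms), the criterion half of Dickson's
theorem that …CubicFormDicksonExact (`tce_dickson_exact`: `2·#q ∈ {2ⁿ − 2ⁿ⁻ʰ, 2ⁿ, 2ⁿ + 2ⁿ⁻ʰ}`) does not expose: a function `q` on `𝔽₂ⁿ`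
whose second derivative is a form `B` (i.e. `deg q ≤ 2`) takes the value `1` exactly `2ⁿ⁻¹` times IFF `q(t) ≠ q(0)` for some `t` in the
radical `Rad B = {t : B(t, ·) = 0}`.  (⇐) translation by `t` flips `q`; (⇒) double counting of `{(x, t) : q(x) = q(x ⊕ t)}`: it has
`2ⁿ · 2ⁿ⁻¹` elements when `q` is balanced, and `#Rad · 2ⁿ + (2ⁿ − #Rad) · 2ⁿ⁻¹` elements when `q` is constant on the radical.  It is the
tool that turns the fibre weights `16 / 48` versus `32` of cell lemma L-T (`h = 1`, HOME/b2b-cforr-cert-g39/E1280-HANDPROOFS.md App. A.3)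
into the algebraic type condition "`ℓ_u ∈ span(l₁, l₂)`" (…CubicFormFibreH1).  Nothing about `θ₁₂`; NOT summit progress.

* `tcb_form_basic`: symmetry, additivity, alternation of `B` and the translation formula `q(x ⊕ t) = q(x) ⊕ q(0) ⊕ q(t) ⊕ B(x,t)`.
* `tcb_balanced_iff`: `2·#{q = 1} = 2ⁿ ↔ ∃ t ∈ Rad B, q t ≠ q 0`.

References: L. E. Dickson (1901); MacWilliams–Sloane (1977) Ch. 15 §2.  Axioms: the standard three.
-/

set_option linter.dupNamespace false -- D-0017: single-problem summit ⇒ `QuantumAdvantage.QuantumAdvantage` by design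

namespace Summit.QuantumAdvantage.QuantumAdvantage.Theorems.CubicForrelation.NearExactIsExact

open Finset
open Literature.Computability.QuantumComplexity.BuzetChailloux (bxor zeroVec bxor_comm bxor_self bxor_zeroVec zeroVec_bxor
  bxor_bxor_cancel_left)

variable {n : ℕ}

/-- **Basic identities of the second derivative.**  If `Δ_{v,w} q (x) = B(v,w)` for all `x`, then `B` is symmetric, additive and
alternating, and `q(x ⊕ t) = q(x) ⊕ (q(0) ⊕ q(t)) ⊕ B(x,t)`. [folklore] -/
theorem tcb_form_basic (q : (Fin n → Bool) → Bool) (B : (Fin n → Bool) → (Fin n → Bool) → Bool)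
    (hB : ∀ v w x, ((q x ^^ q (bxor x w)) ^^ (q (bxor x v) ^^ q (bxor (bxor x v) w))) = B v w) :
    (∀ v w, B v w = B w v) ∧ (∀ u v w, B (bxor u v) w = (B u w ^^ B v w)) ∧ (∀ v, B v v = false) ∧
    (∀ x t, q (bxor x t) = ((q x ^^ (q zeroVec ^^ q t)) ^^ B x t)) := by
  refine ⟨fun v w => ?_, fun u v w => ?_, fun v => ?_, fun x t => ?_⟩
  · rw [← hB v w zeroVec, ← hB w v zeroVec, iw_bxor_assoc, iw_bxor_assoc, bxor_comm v w]
    cases q zeroVec <;> cases q (bxor zeroVec w) <;> cases q (bxor zeroVec v) <;> cases q (bxor zeroVec (bxor w v)) <;> rfl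
  · rw [← hB (bxor u v) w zeroVec, ← hB u w zeroVec, ← hB v w u]
    simp only [zeroVec_bxor]
    cases q zeroVec <;> cases q w <;> cases q u <;> cases q (bxor u w) <;> cases q (bxor u v) <;>
      cases q (bxor (bxor u v) w) <;> rfl
  · rw [← hB v v zeroVec]
    simp only [zeroVec_bxor, bxor_self]
    cases q zeroVec <;> cases q v <;> rfl
  · have e := hB x t zeroVec
    simp only [zeroVec_bxor] at e
    rw [← e]
    cases q zeroVec <;> cases q t <;> cases q x <;> cases q (bxor x t) <;> rfl

/-- **Balanced iff non-constant on the radical.**  For `q : 𝔽₂ⁿ → 𝔽₂` with second derivative the form `B`: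
`2·#{q = 1} = 2ⁿ ↔ ∃ t, B(t, ·) = 0 ∧ q t ≠ q 0`. [folklore; cite: MacWilliamsSloane1977, Ch. 15 §2] -/
theorem tcb_balanced_iff (q : (Fin n → Bool) → Bool) (B : (Fin n → Bool) → (Fin n → Bool) → Bool)
    (hB : ∀ v w x, ((q x ^^ q (bxor x w)) ^^ (q (bxor x v) ^^ q (bxor (bxor x v) w))) = B v w) :
    2 * #(univ.filter fun x : Fin n → Bool => q x = true) = 2 ^ n ↔ ∃ t, (∀ y, B t y = false) ∧ q t ≠ q zeroVec := by
  classical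
  obtain ⟨hsymm, hadd, -, htr⟩ := tcb_form_basic q B hB
  have hU : #(univ : Finset (Fin n → Bool)) = 2 ^ n := by
    rw [card_univ, Fintype.card_fun, Fintype.card_bool, Fintype.card_fin]
  constructor
  · intro hbal
    by_contra hnone
    push Not at hnone
    -- `hnone : ∀ t, (∀ y, B t y = false) → q t = q zeroVec`: `q` is constant on the radical
    set Rad := univ.filter fun t : Fin n → Bool => ∀ y, B t y = false with hRad
    -- for each `t`, count the `x` with `q x = q (x ⊕ t)` (doubled)
    have hcount : ∀ t, 2 * #(univ.filter fun x : Fin n → Bool => q x = q (bxor x t)) =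
        2 ^ n + (if (∀ y, B t y = false) then 2 ^ n else 0) := by
      intro t
      split_ifs with ht
      · have hall : (univ.filter fun x : Fin n → Bool => q x = q (bxor x t)) = univ := by
          apply eq_univ_of_forall
          intro x
          rw [mem_filter]
          refine ⟨mem_univ _, ?_⟩
          rw [htr x t, hnone t ht, hsymm x t, ht x]
          cases q x <;> cases q zeroVec <;> rfl
        rw [hall, hU]; omega
      · push Not at ht
        obtain ⟨y₀, hy₀⟩ := ht
        have hy : B y₀ t = true := by rw [hsymm]; revert hy₀; cases B t y₀ <;> simp
        have hflip : ∀ x, (q (bxor x y₀) ^^ q (bxor (bxor x y₀) t)) = !(q x ^^ q (bxor x t)) := by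
          intro x
          rw [htr (bxor x y₀) t, htr x y₀, htr x t, hadd x y₀ t, hy]
          cases q x <;> cases q zeroVec <;> cases q t <;> cases q y₀ <;> cases B x t <;> cases B x y₀ <;> rfl
        have e : 2 * #(univ.filter fun x : Fin n → Bool => (q x ^^ q (bxor x t)) = false) = #(univ : Finset (Fin n → Bool)) :=
          (tce_half (univ : Finset (Fin n → Bool)) y₀ (fun x => (q x ^^ q (bxor x t))) (fun x _ => mem_univ _) (fun x _ => hflip x)).2
        have hset : (univ.filter fun x : Fin n → Bool => q x = q (bxor x t)) =
            univ.filter fun x : Fin n → Bool => (q x ^^ q (bxor x t)) = false :=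
          filter_congr fun x _ => by cases q x <;> cases q (bxor x t) <;> decide
        rw [hset, e, hU]; simp
    -- the radical part of the count
    have hRad_sum : ∑ t : Fin n → Bool, (if (∀ y, B t y = false) then 2 ^ n else 0) = 2 ^ n * #Rad := by
      rw [hRad, card_filter, mul_sum]
      refine sum_congr rfl fun t _ => ?_
      split_ifs <;> simp
    have hS1 : ∑ t : Fin n → Bool, 2 * #(univ.filter fun x : Fin n → Bool => q x = q (bxor x t)) = 2 ^ n * 2 ^ n + 2 ^ n * #Rad := by
      rw [sum_congr rfl fun t _ => hcount t, sum_add_distrib, sum_const, hU, smul_eq_mul, hRad_sum]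
    -- the same count fibred over `x`: every fibre is balanced
    have hA' : 2 * #(univ.filter fun y : Fin n → Bool => q y = false) = 2 ^ n := by
      have e := card_filter_add_card_filter_not (s := (univ : Finset (Fin n → Bool))) (fun y => q y = true)
      have : (univ.filter fun y : Fin n → Bool => ¬ q y = true) = univ.filter fun y : Fin n → Bool => q y = false :=
        filter_congr fun y _ => by simp
      rw [this, hU] at e; omega
    have hinner : ∀ x, 2 * #(univ.filter fun t : Fin n → Bool => q x = q (bxor x t)) = 2 ^ n := by
      intro x
      have himg : (univ.filter fun t : Fin n → Bool => q x = q (bxor x t)) =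
          (univ.filter fun y : Fin n → Bool => q y = q x).image (bxor x) := by
        ext t
        simp only [mem_filter, mem_univ, true_and, mem_image]
        constructor
        · intro h; exact ⟨bxor x t, h.symm, bxor_bxor_cancel_left x t⟩
        · rintro ⟨y, hy, rfl⟩; rw [bxor_bxor_cancel_left]; exact hy.symm
      rw [himg, card_image_of_injective _ (fun a b hab => by
        simpa only [bxor_bxor_cancel_left] using congrArg (bxor x) hab)]
      cases q x
      · exact hA'
      · exact hbal
    have hswap : ∑ t : Fin n → Bool, #(univ.filter fun x : Fin n → Bool => q x = q (bxor x t)) =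
        ∑ x : Fin n → Bool, #(univ.filter fun t : Fin n → Bool => q x = q (bxor x t)) := by
      simp only [card_filter]
      exact sum_comm
    have hS2 : ∑ t : Fin n → Bool, 2 * #(univ.filter fun x : Fin n → Bool => q x = q (bxor x t)) = 2 ^ n * 2 ^ n := by
      rw [← mul_sum, hswap, mul_sum, sum_congr rfl fun x _ => hinner x, sum_const, hU, smul_eq_mul]
    -- hence the radical is empty — but it contains `0`
    have hRad0 : #Rad = 0 := by
      have h0 : 2 ^ n * #Rad = 0 := by omega
      rcases mul_eq_zero.1 h0 with h | h
      · exact absurd h (Nat.two_pow_pos n).ne'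
      · exact h
    have hz : zeroVec ∈ Rad := by
      rw [hRad, mem_filter]
      refine ⟨mem_univ _, fun y => ?_⟩
      have e := hadd zeroVec zeroVec y
      rw [bxor_self] at e
      revert e; cases B zeroVec y <;> decide
    rw [card_eq_zero] at hRad0
    rw [hRad0] at hz
    exact notMem_empty _ hz
  · rintro ⟨t, ht, hq⟩
    have hflip : ∀ x, q (bxor x t) = !q x := by
      intro x
      rw [htr x t, hsymm x t, ht x]
      revert hq; cases q zeroVec <;> cases q t <;> cases q x <;> decide
    have e := (tce_half (univ : Finset (Fin n → Bool)) t q (fun x _ => mem_univ _) (fun x _ => hflip x)).1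
    rw [hU] at e
    exact e

end Summit.QuantumAdvantage.QuantumAdvantage.Theorems.CubicForrelation.NearExactIsExact
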